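import Literature.Geometry.ComplexHyperbolic.UnitBallLieAlgebraHCDictionary          -- (d2) FILE 2 (owner F0P3a-p05 (g15)): `norm_iteratedFDeriv_liePhi_le_of_orders_lt_four`; brings ★ HCClosure, ★ (b3) HCCubic
import Literature.Analysis.Calculus.LineIntegrationBootstrapWeylChambers              -- ★ (d2) FILE 3a p846634: `LineBootstrap.weylChamber_norm_iteratedFDeriv_bounded_of_uniform_loss`
import Literature.Geometry.ComplexHyperbolic.UnitBallRegularOrbitDRegimeBound         -- ★ p844060: `exists_measure_real_setOf_norm_22_sq_le_eq` (Haar volume of the one-level support `C·ρ²`)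
import Literature.Geometry.ComplexHyperbolic.UnitBallLieAlgebraCrudeJetBound           -- ★ (c3′) p846653 (p09 (g2)): `exists_norm_iteratedFDeriv_liePhi_le_inv_pow_ten` (N = 10)
import HarnessLib

/-!
# Bounded jets of Harish-Chandra's `φ_f` on every Weyl chamber of `𝔲(2,1)` near `0` (ROAD «A6-IV» brick (d2) FILE 3b «CHAMBER JETS» — the assembly; Warner II Thm. 8.4.3.1)

Topic `Geometry/ComplexHyperbolic`; namespace `Literature.Geometry.ComplexHyperbolic.BallModel`.  THEOREMS ONLY (no `def`, no instance, no notation, no axiom, no named fact, no `sorry`).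
Cell `pub/hodgecm-mathlib`, ENGINE T1 (crux H413 = `stmt-HodgeConjecture-24833`); ROAD A, design of record `DESIGN-A6-InHouse-v2-ArchitectureIV` 93542b84 (LEAD T11-4); owner∕pen F0P3a-p05
(g15) (R-15.9 (2) the (d2) plan, head text 20:03:22Z); second by paste F0P3-p01 (g17) (architect A-152), 2026-09-01.

THE MATHEMATICS.  §1 **THE `N`-AGNOSTIC ASSEMBLY** `chamber_forall_norm_iteratedFDeriv_liePhi_bounded_of_crude`: for `μ` finite on compacta and right-invariant and `f ∈ C_c^∞(M₃(ℂ); E)`, IF every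
`h ∈ C^∞` with `tsupport h ⊆ tsupport f` obeys a CRUDE bound at orders `i < 4` — `‖Dⁱ(liePhi μ h)(θ)‖ ≤ C·(min(|θ₀−θ₂|,|θ₁−θ₂|))^{−N}` at all regular `θ` of the unit ball, ONE `N` — then
`‖Dⁿ(liePhi μ f)‖` is BOUNDED on every permutation chamber `{θ_{σ0} < θ_{σ1} < θ_{σ2}} ∩ B(0,¼)`, for every `n`: (d2) FILE 2's reduction ★ `norm_iteratedFDeriv_liePhi_le_of_orders_lt_four`
(all orders from orders `< 4` with the SAME weight, Harish-Chandra's uniform exponent via the holonomic system (E1)(E2)(E3) and the six `S₃`-harmonics) on `S = {rootProduct ≠ 0} ∩ {‖θ‖ < 1}`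
with `w = (min …)^{−N}`, then FILE 3a's line-integration bootstrap on the six chambers ★ `weylChamber_norm_iteratedFDeriv_bounded_of_uniform_loss` (`φ = liePhi μ f` is `C^∞` on the open
regular set ★ `contDiffOn_liePhi`, which contains the pairwise-distinct points ★ `rootProduct_ne_zero_iff`).  §2 THE HEAD over the crude bound ★ (c3′) `exists_norm_iteratedFDeriv_liePhi_le_inv_pow_ten` (`N = 10`) and the Haar volume of the one-level
support ★ `exists_measure_real_setOf_norm_22_sq_le_eq` (support radius inherited by every `h` ★ `norm_le_of_ne_zero_of_tsupport_subset`), and its `∀ μ f σ n` package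
`liePhi_chamberJetBounds` = the `hball` hypothesis of ★ (f1) `ArchCentralLimitFormulaRankTwo.of_liePhiJetBounds_of_values` VERBATIM (`E = ℂ`).
HONEST LABEL: HC_CM is proved only modulo the printed citations until rung 0 closes; assembly, pays nothing by itself (consumer: (f1) ★ `letterJetBound_of_liePhiJetBounds`'s `hball`).

## References
* [WarnerHASSLG2] G. Warner, *Harmonic Analysis on Semi-Simple Lie Groups II*, Grundlehren 189 (1972), §8.4.3, Thm. 8.4.3.1 and its proof.
* [HarishChandra1957DiffOps] Harish-Chandra, *Differential operators on a semisimple Lie algebra*, Amer. J. Math. 79 (1957) 87–120, Thm. 1, §§2–3.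
-/

set_option autoImplicit false

noncomputable section

namespace Literature.Geometry.ComplexHyperbolic

namespace BallModel

open _root_.Complex _root_.Matrix _root_.MeasureTheory _root_.Set _root_.Filter _root_.Topology _root_.Metric
open Literature.Analysis.Calculus
open scoped Matrix.Norms.Operator ComplexConjugate ContDiff

variable {E : Type*} [NormedAddCommGroup E] [NormedSpace ℝ E] [CompleteSpace E]

/-! ## §1 The `N`-agnostic assembly: crude bounds at orders `< 4` ⇒ bounded jets of all orders on every chamber -/

section Assembly

/-- **BOUNDED JETS ON EVERY WEYL CHAMBER FROM A CRUDE BOUND AT ORDERS `< 4`** (Warner II, proof of Thm. 8.4.3.1, assembled): `μ` finite on compacta and right-invariant, `f ∈ C_c^∞(M₃(ℂ); E)`;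
if for every `h ∈ C^∞` with `tsupport h ⊆ tsupport f` and every `i < 4` there is `C ≥ 0` with `‖Dⁱ(liePhi μ h)(θ)‖ ≤ C·(min(|θ₀−θ₂|,|θ₁−θ₂|)^N)⁻¹` at every regular `θ` with `‖θ‖ < 1` (ONE `N`),
then for every permutation `σ` and every order `n`, `‖Dⁿ(liePhi μ f)‖` is bounded on `{θ_{σ0} < θ_{σ1} < θ_{σ2}} ∩ B(0,¼)`. [cite: WarnerHASSLG2, §8.4.3, Thm. 8.4.3.1] -/
theorem chamber_forall_norm_iteratedFDeriv_liePhi_bounded_of_crude (μ : Measure U21) [IsFiniteMeasureOnCompacts μ] [μ.IsMulRightInvariant] {f : Matrix (Fin 3) (Fin 3) ℂ → E}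
    (hf : ContDiff ℝ ∞ f) (hfc : HasCompactSupport f) (N : ℕ)
    (hcrude : ∀ h : Matrix (Fin 3) (Fin 3) ℂ → E, ContDiff ℝ ∞ h → tsupport h ⊆ tsupport f → ∀ i : ℕ, i < 4 →
      ∃ C : ℝ, 0 ≤ C ∧ ∀ θ : Fin 3 → ℝ, rootProduct θ ≠ 0 → ‖θ‖ < 1 → ‖iteratedFDeriv ℝ i (liePhi μ h) θ‖ ≤ C * ((min |θ 0 - θ 2| |θ 1 - θ 2|) ^ N)⁻¹)
    (σ : Equiv.Perm (Fin 3)) (n : ℕ) :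
    ∃ M : ℝ, ∀ θ ∈ {θ : Fin 3 → ℝ | θ (σ 0) < θ (σ 1) ∧ θ (σ 1) < θ (σ 2)} ∩ ball 0 (1 / 4), ‖iteratedFDeriv ℝ n (liePhi μ f) θ‖ ≤ M := by
  -- Step 1 (FILE 2): all orders from orders `< 4`, same weight, on `S = {rootProduct ≠ 0} ∩ {‖θ‖ < 1}`
  have hS : {θ : Fin 3 → ℝ | rootProduct θ ≠ 0 ∧ ‖θ‖ < 1} ⊆ {θ : Fin 3 → ℝ | rootProduct θ ≠ 0} := fun θ hθ => hθ.1
  have hred := norm_iteratedFDeriv_liePhi_le_of_orders_lt_four μ hf hfc {θ : Fin 3 → ℝ | rootProduct θ ≠ 0 ∧ ‖θ‖ < 1} hS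
    (fun θ : Fin 3 → ℝ => ((min |θ 0 - θ 2| |θ 1 - θ 2|) ^ N)⁻¹)
    (fun h hh hsub i hi => by
      obtain ⟨C, hC0, hC⟩ := hcrude h hh hsub i hi
      exact ⟨C, hC0, fun θ hθ => hC θ hθ.1 hθ.2⟩)
  -- Step 2 (FILE 3a): the bootstrap on the six chambers, `φ = liePhi μ f` smooth on the open regular set
  refine LineBootstrap.weylChamber_norm_iteratedFDeriv_bounded_of_uniform_loss (liePhi μ f) isOpen_setOf_rootProduct_ne_zero (contDiffOn_liePhi μ hf hfc) ?_ N ?_ σ n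
  · intro θ hθ
    exact (rootProduct_ne_zero_iff θ).2 hθ.1
  · intro m
    obtain ⟨C, hC0, hC⟩ := hred m
    exact ⟨C, hC0, fun θ hθ hθ1 => hC θ ⟨(rootProduct_ne_zero_iff θ).2 hθ, hθ1⟩⟩

omit [NormedSpace ℝ E] [CompleteSpace E] in
/-- A compactly supported `f` is carried by a closed ball: `∃ R, ∀ X, f X ≠ 0 → ‖X‖ ≤ R`. [cite: WarnerHASSLG2, §8.4.1] -/
theorem exists_norm_le_of_ne_zero {f : Matrix (Fin 3) (Fin 3) ℂ → E} (hfc : HasCompactSupport f) : ∃ R : ℝ, ∀ X, f X ≠ 0 → ‖X‖ ≤ R := by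
  obtain ⟨R, hR⟩ := hfc.isCompact.isBounded.subset_closedBall 0
  exact ⟨R, fun X hX => by simpa using hR (subset_tsupport _ (Function.mem_support.2 hX))⟩

end Assembly

/-! ## §2 The head over ★ (c3′) (`N = 10`) and the Haar volume -/

section Head

/-- **BOUNDED JETS OF `φ_f` ON EVERY WEYL CHAMBER NEAR `0`** (Warner II Thm. 8.4.3.1 for `𝔲(2,1)`, `𝔧` the compact Cartan subalgebra): for a right-invariant Haar measure `μ` on `U(2,1)`,
`f ∈ C_c^∞(M₃(ℂ); E)`, every permutation `σ` and every order `n`, `‖Dⁿ(liePhi μ f)‖` is bounded on `{θ_{σ0} < θ_{σ1} < θ_{σ2}} ∩ B(0,¼)` — the `hball` input of ★ (f1)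
`letterJetBound_of_liePhiJetBounds`. [cite: WarnerHASSLG2, §8.4.3, Thm. 8.4.3.1] [cite: HarishChandra1957DiffOps, Thm. 1] -/
theorem chamber_forall_norm_iteratedFDeriv_liePhi_bounded (μ : Measure U21) [μ.IsHaarMeasure] [μ.IsMulRightInvariant] {f : Matrix (Fin 3) (Fin 3) ℂ → E}
    (hf : ContDiff ℝ ∞ f) (hfc : HasCompactSupport f) (σ : Equiv.Perm (Fin 3)) (n : ℕ) :
    ∃ M : ℝ, ∀ θ ∈ {θ : Fin 3 → ℝ | θ (σ 0) < θ (σ 1) ∧ θ (σ 1) < θ (σ 2)} ∩ ball 0 (1 / 4), ‖iteratedFDeriv ℝ n (liePhi μ f) θ‖ ≤ M := by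
  obtain ⟨C, -, hCvol⟩ := exists_measure_real_setOf_norm_22_sq_le_eq μ
  obtain ⟨R, hR⟩ := exists_norm_le_of_ne_zero hfc
  exact chamber_forall_norm_iteratedFDeriv_liePhi_bounded_of_crude μ hf hfc 10
    (fun h hh hsub i hi => exists_norm_iteratedFDeriv_liePhi_le_inv_pow_ten μ (fun ρ hρ => (hCvol ρ hρ).le) hh
      (fun X hX => norm_le_of_ne_zero_of_tsupport_subset hR hsub X hX) hi) σ n

/-- **THE `hball` PACKAGE FOR (f1)** — VERBATIM the hypothesis `hball` of ★ `ArchCentralLimitFormulaRankTwo.of_liePhiJetBounds_of_values` (p846633): for every right-invariant Haar `μ` on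
`U(2,1)` and every complex test function `f ∈ C_c^∞(M₃(ℂ))`, all jets of `liePhi μ f` are bounded on every chamber `C_σ ∩ B(0,¼)`. [cite: WarnerHASSLG2, §8.4.3, Thm. 8.4.3.1] -/
theorem liePhi_chamberJetBounds :
    ∀ (μ : Measure U21) [μ.IsHaarMeasure] [μ.IsMulRightInvariant] (f : Matrix (Fin 3) (Fin 3) ℂ → ℂ), ContDiff ℝ ∞ f → HasCompactSupport f →
      ∀ (σ : Equiv.Perm (Fin 3)) (n : ℕ), ∃ M : ℝ, ∀ θ ∈ {θ : Fin 3 → ℝ | θ (σ 0) < θ (σ 1) ∧ θ (σ 1) < θ (σ 2)} ∩ ball (0 : Fin 3 → ℝ) (1 / 4),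
        ‖iteratedFDeriv ℝ n (liePhi μ f) θ‖ ≤ M :=
  fun μ _ _ _ hf hfc σ n => chamber_forall_norm_iteratedFDeriv_liePhi_bounded μ hf hfc σ n

end Head

end BallModel

end Literature.Geometry.ComplexHyperbolic

end
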